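import Summits.AtomisticToContinuum.HydrodynamicLimit.Theorems.EquilibriumClampedCollisionalWindowLD.Negative.MainBound
import Summits.AtomisticToContinuum.HydrodynamicLimit.Theorems.EquilibriumClampedCollisionalWindowLD.Negative.FinalIneq2

/-!
# Negative knowledge for the crux `TwoClocks.TransferActivityTails` (stmt-AtomisticToContinuum-16624):
# the EXPONENTIAL-MOMENT (large-deviation) strengthening of its equilibrium rung is FALSE — part 1,
# the transfer activity of the Newton-cradle relay along the 13733 certificate (pointwise bounds)

From the standing disprover's workfile `Cruxes/TransferActivityTails/Disproof.lean` §5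
(refuter-cdisprove-stmt-AtomisticToContinuum-16624-0, cycle 1).  Nothing here asserts a Theses declaration.

The crux prices the transfer-activity clamp of C′ = `ClampedTransferWindowLD` in `L¹` currency:
`lim_τ limsup_N E_G[(N+1)⁻¹ Σᵢ aᵢ 𝟙{aᵢ > V}] = 0`, `aᵢ = (σ/τ) Σ_{collisions of i in (0,w]}
(‖Δvᵢ‖ + |Δ‖vᵢ‖²|/2)`.  A clock fed in LARGE-DEVIATION currency would instead want the exponential moment
`∫ exp(β Σᵢ aᵢ 𝟙{aᵢ > V}) dG_N ≤ exp(ε(N+1))` (`TransferActivityTailsExpMoment`, typed below with the crux's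
summand verbatim, at global equilibrium).  THAT statement is false (`transferActivityTailsExpMoment_false`, part 2 `ExpMomentFalse.lean`), by
the frozen line-lattice Newton-cradle witness that refuted ex-crux stmt-13733 (all of whose machinery —
`EquilibriumClampedCollisionalWindowLD/Negative/*`: the lattice `LatW`, the labelled events `Ev`, their Gibbs
weight `measure_Ev_ge`, the identification flow = certificate and the window's collision records
`collisionSum_window` — is REUSED, not restated): on `Ev`, every transfer of the pulse `c ≥ clo ≍ t³` hands the
RECEIVING sphere the energy impulse `(‖η + c n‖² − ‖η‖²)/2 ≥ clo(clo − 2u)/2`, so its transfer activity is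
`≥ (σ/τ)·clo(clo−2u)/2 ≥ (9/100) t²/l² > V` (`τ = t⁴`, `σ = (4/5)/l²`), receivers of distinct transfers are
distinct (`sphJ_inj`), and there are `≥ Tlow` transfers; hence `2β Σᵢ aᵢ𝟙{aᵢ>V} ≥ Fmin N kw β 1` (the 13733
exponent at `Z = 1`, where its equation-of-state term vanishes) and the 13733 final inequality
`exp(N+1) < (N+1)!·exp(Fmin)·evB` closes the contradiction at `β = 2`, `ε = 1`.

MORAL (route text "the L¹ currency is forced", now a theorem for the transfer activity): the clamp remainder of
the clock can only be priced in MEAN; no line may consume an exponential concentration of the activity tail.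
Under the crux's own `L¹` currency the same event contributes `≤ G(Ev)·σt² → 0` and does not bite.
-/

noncomputable section

open Real MeasureTheory
open scoped InnerProductSpace

namespace Summit.AtomisticToContinuum.HydrodynamicLimit.Theorems

namespace TransferActivityTailsNegative

open Literature.Analysis.FluidPDE Literature.Analysis.FunctionSpaces Literature.MathematicalPhysics.KineticTheory
open EquilibriumClampedCollisionalWindowLDNegative EquilibriumClampedCollisionalWindowLDNegative.Lat

/-! ## The typed strengthening -/

/-- **Exponential-moment (LD) strengthening of the equilibrium transfer-activity tails** (NOT the crux; the
crux's summand and window verbatim, constant profiles, canonical Gibbs law):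
`∃V₀ ∀V ≥ V₀ ∀β > 0 ∀ε > 0 ∃τ₀ ∀τ ≥ τ₀ ∃N₀ ∀N ≥ N₀`, `∫ exp(β Σᵢ aᵢ𝟙{aᵢ > V}) dG_N ≤ exp(ε(N+1))`. -/
def TransferActivityTailsExpMoment : Prop :=
  ∀ (a₀ θ₀ : ℝ) (u₀ : V3), 0 < a₀ → 0 < θ₀ → ∃ σ₀ : ℝ, 0 < σ₀ ∧ ∀ σ : ℝ, 0 < σ → σ < σ₀ →
    ∀ Φ : (N : ℕ) → HardSphereFlow (Torus.geometry (Fin 3)) (hsDiameter σ N) (N + 1),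
    ∃ V₀ : ℝ, 0 < V₀ ∧ ∀ V : ℝ, V₀ ≤ V → ∀ β : ℝ, 0 < β → ∀ ε : ℝ, 0 < ε →
    ∃ τ₀ : ℝ, 0 < τ₀ ∧ ∀ τ : ℝ, τ₀ ≤ τ → ∃ N₀ : ℕ, ∀ N : ℕ, N₀ ≤ N →
      ∫⁻ z, ENNReal.ofReal (Real.exp (β * ∑ i : Fin (N + 1),
          Set.indicator {y : ℝ | V < y} (fun y => y)
            (σ / τ * (Φ N).collisionSum (Set.Ioc 0 (τ * ((N : ℝ) + 1) ^ (-(1 / 3 : ℝ))))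
              (fun c => if c.fst = i then
                ‖c.postVel.1 - c.preVel.1‖ + |‖c.postVel.1‖ ^ 2 - ‖c.preVel.1‖ ^ 2| / 2 else 0) z)))
        ∂(localGibbsLaw σ (fun _ => a₀) (fun _ => u₀) (fun _ => θ₀) N (Φ N)) ≤
        ENNReal.ofReal (Real.exp (ε * ((N : ℝ) + 1)))

/-! ## The transfer activity along the certificate -/

section Lattice

variable {Λ : EquilibriumClampedCollisionalWindowLDNegative.Lat} {N : ℕ} {a : Fin (N + 1) ≃ Λ.Slot}
variable {Φ : HardSphereFlow (Torus.geometry (Fin 3)) Λ.P.ε (N + 1)}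

/-- The transfer activity of sphere `p` over the window `(0, w]`, scale `κ = σ/τ` (the crux's `aₚ`). -/
def actT (Λ : EquilibriumClampedCollisionalWindowLDNegative.Lat) {N : ℕ} (Φ : HardSphereFlow (Torus.geometry (Fin 3)) Λ.P.ε (N + 1)) (κ : ℝ) (p : Fin (N + 1))
    (z : Cfg N) : ℝ :=
  κ * Φ.collisionSum (Set.Ioc 0 Λ.w)
    (fun c => if c.fst = p then ‖c.postVel.1 - c.preVel.1‖ + |‖c.postVel.1‖ ^ 2 - ‖c.preVel.1‖ ^ 2| / 2 else 0) z

/-- The per-transfer energy floor `clo (clo − 2u)/2`. -/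
def gRec (P : Params) : ℝ := P.clo * (P.clo - 2 * P.u) / 2

/-- The energy floor is nonnegative. -/
theorem gRec_nonneg (hΛ : Λ.OK) (hG : Λ.GainOK) : 0 ≤ gRec Λ.P := by
  have hclo := hΛ.sep.adm.clo_pos
  unfold gRec
  have : 0 ≤ Λ.P.clo * (Λ.P.clo - 2 * Λ.P.u) := mul_nonneg hclo.le (by linarith [hG.u_le])
  positivity

/-- The 13733 gain is at most `2 ε` times the energy floor (`κ₀ ≤ 2`, `1 − αn²/2 ≤ 1`). -/
theorem gainT_le (hΛ : Λ.OK) (hG : Λ.GainOK) : gainT Λ.P ≤ 2 * Λ.P.ε * gRec Λ.P := by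
  have hP := hΛ.sep.adm
  have hε := hP.ε_pos
  have hαn0 : 0 ≤ Λ.P.αn := hP.αn_nn
  have hδ0 : 0 ≤ Λ.P.errA + Λ.P.fwd := by
    have := hP.errA_nn; have := (e1_le_errA (Λ := Λ) hP).2; linarith
  have hB0 : 0 ≤ Λ.P.clo * (Λ.P.clo - 2 * Λ.P.u) := mul_nonneg hP.clo_pos.le (by linarith [hG.u_le])
  set κ₀ := 2 - 4 * (2 * Real.pi * (Λ.P.errA + Λ.P.fwd) + Real.pi * Λ.P.ε) with hκ₀
  have hκ₀0 : 0 ≤ κ₀ := by rw [hκ₀]; linarith [hG.h_le]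
  have hκ₀2 : κ₀ ≤ 2 := by
    rw [hκ₀]
    have hπ := Real.pi_pos
    have : 0 ≤ 2 * Real.pi * (Λ.P.errA + Λ.P.fwd) + Real.pi * Λ.P.ε := by positivity
    linarith
  have hA : Λ.P.ε * (1 - Λ.P.αn ^ 2 / 2) ≤ Λ.P.ε := by
    have : 0 ≤ Λ.P.αn ^ 2 / 2 := by positivity
    nlinarith
  have hA0 : 0 ≤ Λ.P.ε * (1 - Λ.P.αn ^ 2 / 2) := by
    have hαn1 : Λ.P.αn ≤ 1 := hΛ.sep.αn_le
    exact mul_nonneg hε.le (by nlinarith)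
  have hg : gainT Λ.P = κ₀ * (Λ.P.ε * (1 - Λ.P.αn ^ 2 / 2)) * (Λ.P.clo * (Λ.P.clo - 2 * Λ.P.u)) / 2 := by
    rw [gainT, hκ₀]
  rw [hg, gRec]
  have h1 : κ₀ * (Λ.P.ε * (1 - Λ.P.αn ^ 2 / 2)) ≤ 2 * Λ.P.ε := mul_le_mul hκ₀2 hA hA0 zero_le_two
  have := mul_le_mul_of_nonneg_right h1 hB0
  linarith

/-- **The receiving sphere of a transfer is hyperactive**: its windowed transfer impulse is at least the energy
floor (the energy impulse of its receiving record alone: `(‖η + c n‖² − ‖η‖²)/2 = c⟪η,n⟫ + c²/2 ≥ c²/2 − cu`,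
monotone in `c ≥ clo ≥ 2u`). -/
theorem collisionSum_transfer_ge (hW : Λ.WinOK) (hG : Λ.GainOK) (hε : Λ.P.ε < 1 / 2) {z : Cfg N}
    (hz : z ∈ Λ.Ev a) (hgood : z ∈ Φ.good) {tr : ℕ × (Fin Λ.n × Fin Λ.n) × ℕ} (htr : tr ∈ Λ.transfers a z) :
    gRec Λ.P ≤ Φ.collisionSum (Set.Ioc 0 Λ.w)
      (fun c => if c.fst = Λ.sphJ a tr then
        ‖c.postVel.1 - c.preVel.1‖ + |‖c.postVel.1‖ ^ 2 - ‖c.preVel.1‖ ^ 2| / 2 else 0) z := by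
  classical
  have hΛ := hW.ok
  have hP := hΛ.sep.adm
  rw [collisionSum_window hW hε hz hgood]
  -- every summand is nonnegative
  have hnn : ∀ tr' ∈ Λ.transfers a z, 0 ≤
      ((if (HardSphereCollisionRecord.ofConfig (Torus.geometry (Fin 3)) Λ.P.ε (Λ.cert a z (Λ.ttime a z tr'))
            (Λ.ttime a z tr') (Λ.sphI a tr') (Λ.sphJ a tr')).fst = Λ.sphJ a tr then
          ‖(HardSphereCollisionRecord.ofConfig (Torus.geometry (Fin 3)) Λ.P.ε (Λ.cert a z (Λ.ttime a z tr'))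
              (Λ.ttime a z tr') (Λ.sphI a tr') (Λ.sphJ a tr')).postVel.1 -
            (HardSphereCollisionRecord.ofConfig (Torus.geometry (Fin 3)) Λ.P.ε (Λ.cert a z (Λ.ttime a z tr'))
              (Λ.ttime a z tr') (Λ.sphI a tr') (Λ.sphJ a tr')).preVel.1‖ +
          |‖(HardSphereCollisionRecord.ofConfig (Torus.geometry (Fin 3)) Λ.P.ε (Λ.cert a z (Λ.ttime a z tr'))
              (Λ.ttime a z tr') (Λ.sphI a tr') (Λ.sphJ a tr')).postVel.1‖ ^ 2 -
            ‖(HardSphereCollisionRecord.ofConfig (Torus.geometry (Fin 3)) Λ.P.ε (Λ.cert a z (Λ.ttime a z tr'))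
              (Λ.ttime a z tr') (Λ.sphI a tr') (Λ.sphJ a tr')).preVel.1‖ ^ 2| / 2 else 0) +
       (if (HardSphereCollisionRecord.ofConfig (Torus.geometry (Fin 3)) Λ.P.ε (Λ.cert a z (Λ.ttime a z tr'))
            (Λ.ttime a z tr') (Λ.sphJ a tr') (Λ.sphI a tr')).fst = Λ.sphJ a tr then
          ‖(HardSphereCollisionRecord.ofConfig (Torus.geometry (Fin 3)) Λ.P.ε (Λ.cert a z (Λ.ttime a z tr'))
              (Λ.ttime a z tr') (Λ.sphJ a tr') (Λ.sphI a tr')).postVel.1 -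
            (HardSphereCollisionRecord.ofConfig (Torus.geometry (Fin 3)) Λ.P.ε (Λ.cert a z (Λ.ttime a z tr'))
              (Λ.ttime a z tr') (Λ.sphJ a tr') (Λ.sphI a tr')).preVel.1‖ +
          |‖(HardSphereCollisionRecord.ofConfig (Torus.geometry (Fin 3)) Λ.P.ε (Λ.cert a z (Λ.ttime a z tr'))
              (Λ.ttime a z tr') (Λ.sphJ a tr') (Λ.sphI a tr')).postVel.1‖ ^ 2 -
            ‖(HardSphereCollisionRecord.ofConfig (Torus.geometry (Fin 3)) Λ.P.ε (Λ.cert a z (Λ.ttime a z tr'))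
              (Λ.ttime a z tr') (Λ.sphJ a tr') (Λ.sphI a tr')).preVel.1‖ ^ 2| / 2 else 0)) := by
    intro tr' _
    refine add_nonneg ?_ ?_ <;> split_ifs <;> positivity
  refine le_trans ?_ (Finset.single_le_sum hnn htr)
  -- the receiving record of `tr`
  obtain ⟨hb, hj, hact, -⟩ := mem_transfers.1 htr
  have hD := dataOK_of_mem hΛ hz hact tr.2.1
  have hf := stepFacts hP hD (by omega : tr.2.2 + 1 ≤ Λ.P.K)
  have hn1 : ‖Λ.trN a z tr‖ = 1 := hf.cont.n_unit
  obtain ⟨-, hpj⟩ := preVel_transfer hW hz htr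
  obtain ⟨-, hvj⟩ := cert_snd_transfer hW hz htr
  set c := Λ.trC a z tr with hc
  have hcge : Λ.P.clo ≤ c := hf.cont.c_ge
  have hη : ‖Λ.trη a z tr‖ ≤ Λ.P.u := hD.η_le (tr.2.2 + 1) (by omega) (by omega)
  have hu := hP.u_nn
  have hclo := hP.clo_pos
  have hc0 : 0 ≤ c := hclo.le.trans hcge
  -- the energy gain of the receiver
  have hexp : ‖Λ.trη a z tr + c • Λ.trN a z tr‖ ^ 2 - ‖Λ.trη a z tr‖ ^ 2 =
      2 * (c * ⟪Λ.trη a z tr, Λ.trN a z tr⟫_ℝ) + c ^ 2 := by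
    rw [norm_add_sq_real, real_inner_smul_right, norm_smul, hn1, mul_one, Real.norm_eq_abs, sq_abs]; ring
  have hin : -Λ.P.u ≤ ⟪Λ.trη a z tr, Λ.trN a z tr⟫_ℝ := by
    have h1 := abs_real_inner_le_norm (Λ.trη a z tr) (Λ.trN a z tr)
    rw [hn1, mul_one] at h1
    have := neg_abs_le (⟪Λ.trη a z tr, Λ.trN a z tr⟫_ℝ)
    linarith
  have hin' : c * (-Λ.P.u) ≤ c * ⟪Λ.trη a z tr, Λ.trN a z tr⟫_ℝ := mul_le_mul_of_nonneg_left hin hc0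
  have hmono : Λ.P.clo * (Λ.P.clo - 2 * Λ.P.u) ≤ c ^ 2 - 2 * (c * Λ.P.u) := by
    have h := mul_nonneg (sub_nonneg.2 hcge) (by linarith [hG.u_le] : 0 ≤ c + Λ.P.clo - 2 * Λ.P.u)
    nlinarith [h]
  have hB : Λ.P.clo * (Λ.P.clo - 2 * Λ.P.u) ≤ ‖Λ.trη a z tr + c • Λ.trN a z tr‖ ^ 2 - ‖Λ.trη a z tr‖ ^ 2 := by
    rw [hexp]; linarith
  -- drop the giving record, read the receiving one
  have hfirst : 0 ≤ (if (HardSphereCollisionRecord.ofConfig (Torus.geometry (Fin 3)) Λ.P.ε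
        (Λ.cert a z (Λ.ttime a z tr)) (Λ.ttime a z tr) (Λ.sphI a tr) (Λ.sphJ a tr)).fst = Λ.sphJ a tr then
          ‖(HardSphereCollisionRecord.ofConfig (Torus.geometry (Fin 3)) Λ.P.ε (Λ.cert a z (Λ.ttime a z tr))
              (Λ.ttime a z tr) (Λ.sphI a tr) (Λ.sphJ a tr)).postVel.1 -
            (HardSphereCollisionRecord.ofConfig (Torus.geometry (Fin 3)) Λ.P.ε (Λ.cert a z (Λ.ttime a z tr))
              (Λ.ttime a z tr) (Λ.sphI a tr) (Λ.sphJ a tr)).preVel.1‖ +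
          |‖(HardSphereCollisionRecord.ofConfig (Torus.geometry (Fin 3)) Λ.P.ε (Λ.cert a z (Λ.ttime a z tr))
              (Λ.ttime a z tr) (Λ.sphI a tr) (Λ.sphJ a tr)).postVel.1‖ ^ 2 -
            ‖(HardSphereCollisionRecord.ofConfig (Torus.geometry (Fin 3)) Λ.P.ε (Λ.cert a z (Λ.ttime a z tr))
              (Λ.ttime a z tr) (Λ.sphI a tr) (Λ.sphJ a tr)).preVel.1‖ ^ 2| / 2 else 0) := by
    split_ifs <;> positivity
  refine le_trans ?_ (le_add_of_nonneg_left hfirst)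
  simp only [HardSphereCollisionRecord.ofConfig_fst, if_true, HardSphereCollisionRecord.ofConfig_postVel, hpj, hvj]
  have habs : ‖Λ.trη a z tr + c • Λ.trN a z tr‖ ^ 2 - ‖Λ.trη a z tr‖ ^ 2 ≤
      |‖Λ.trη a z tr + c • Λ.trN a z tr‖ ^ 2 - ‖Λ.trη a z tr‖ ^ 2| := le_abs_self _
  have hnorm : 0 ≤ ‖Λ.trη a z tr + c • Λ.trN a z tr - Λ.trη a z tr‖ := norm_nonneg _
  unfold gRec
  linarith

/-- **The tail sum on a labelled event**: if the activity floor `κ · gRec` exceeds the level `V`, then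
`Tlow · κ · gRec ≤ Σₚ aₚ 𝟙{aₚ > V}` (distinct transfers have distinct receivers; `≥ Tlow` transfers). -/
theorem tailSum_ge (hW : Λ.WinOK) (hG : Λ.GainOK) (hε : Λ.P.ε < 1 / 2) {z : Cfg N} (hz : z ∈ Λ.Ev a)
    (hgood : z ∈ Φ.good) {κ V : ℝ} (hκ : 0 ≤ κ) (hV : V < κ * gRec Λ.P) {kw : ℕ} (hkK : kw + 1 ≤ Λ.P.K)
    (hkw : (kw : ℝ) * Λ.P.θhi ≤ Λ.w) (hM : 24 * Λ.m ≤ Λ.M) :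
    Λ.Tlow kw * (κ * gRec Λ.P) ≤
      ∑ p : Fin (N + 1), Set.indicator {y : ℝ | V < y} (fun y => y) (actT Λ Φ κ p z) := by
  classical
  have hΛ := hW.ok
  have hg0 := gRec_nonneg hΛ hG
  -- every sphere's tail term is nonnegative
  have hact0 : ∀ p, 0 ≤ actT Λ Φ κ p z := by
    intro p
    unfold actT
    refine mul_nonneg hκ ?_
    rw [HardSphereFlow.collisionSum_eq, collisionSum_eq_collisionPairSum]
    exact collisionPairSum_nonneg fun _ _ _ => by split_ifs <;> positivity
  have htail0 : ∀ p, 0 ≤ Set.indicator {y : ℝ | V < y} (fun y => y) (actT Λ Φ κ p z) := fun p =>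
    Set.indicator_apply_nonneg fun _ => hact0 p
  -- the receivers are hyperactive
  have hrecv : ∀ tr ∈ Λ.transfers a z,
      κ * gRec Λ.P ≤ Set.indicator {y : ℝ | V < y} (fun y => y) (actT Λ Φ κ (Λ.sphJ a tr) z) := by
    intro tr htr
    have h1 : κ * gRec Λ.P ≤ actT Λ Φ κ (Λ.sphJ a tr) z :=
      mul_le_mul_of_nonneg_left (collisionSum_transfer_ge hW hG hε hz hgood htr) hκ
    rw [Set.indicator_of_mem (show actT Λ Φ κ (Λ.sphJ a tr) z ∈ {y : ℝ | V < y} from hV.trans_le h1)]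
    exact h1
  -- count
  have hT : Λ.Tlow kw ≤ ((Λ.transfers a z).card : ℝ) := by
    have h1 := card_transfers_ge (a := a) hΛ hz hkK hkw
    have h2 := card_active_ge Λ hΛ hM
    have h1' : ((((Finset.range Λ.Q).filter Λ.Active).card * (Λ.n * Λ.n) * kw : ℕ) : ℝ) ≤ (Λ.transfers a z).card := by
      exact_mod_cast h1
    push_cast at h1'
    unfold Lat.Tlow
    have : (0 : ℝ) ≤ (Λ.n : ℝ) * Λ.n * kw := by positivity
    nlinarith
  calc Λ.Tlow kw * (κ * gRec Λ.P) ≤ ((Λ.transfers a z).card : ℝ) * (κ * gRec Λ.P) :=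
        mul_le_mul_of_nonneg_right hT (mul_nonneg hκ hg0)
    _ = ∑ _tr ∈ Λ.transfers a z, κ * gRec Λ.P := by rw [Finset.sum_const, nsmul_eq_mul]
    _ ≤ ∑ tr ∈ Λ.transfers a z, Set.indicator {y : ℝ | V < y} (fun y => y) (actT Λ Φ κ (Λ.sphJ a tr) z) :=
        Finset.sum_le_sum hrecv
    _ = ∑ p ∈ (Λ.transfers a z).image (Λ.sphJ a), Set.indicator {y : ℝ | V < y} (fun y => y) (actT Λ Φ κ p z) := by
        rw [Finset.sum_image fun tr htr tr' htr' h => sphJ_inj hΛ htr htr' h]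
    _ ≤ ∑ p : Fin (N + 1), Set.indicator {y : ℝ | V < y} (fun y => y) (actT Λ Φ κ p z) :=
        Finset.sum_le_univ_sum_of_nonneg fun p => htail0 p

/-- **Pointwise exponent bound on a labelled event**: the 13733 exponent at `Z = 1` is dominated by `B` times
the tail sum as soon as `2β ≤ B` and `ε ≤ κ w` (then `gainT/w ≤ 2κ·gRec`). -/
theorem exponent_ge_tail (hW : Λ.WinOK) (hG : Λ.GainOK) (hε : Λ.P.ε < 1 / 2) (hw0 : 0 < Λ.w) {z : Cfg N}
    (hz : z ∈ Λ.Ev a) (hgood : z ∈ Φ.good) {κ V β B : ℝ} (hκ : 0 ≤ κ) (hV : V < κ * gRec Λ.P) (hβ : 0 ≤ β)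
    (hB : 2 * β ≤ B) (hκε : Λ.P.ε ≤ κ * Λ.w) {kw : ℕ} (hkK : kw + 1 ≤ Λ.P.K) (hkw : (kw : ℝ) * Λ.P.θhi ≤ Λ.w)
    (hM : 24 * Λ.m ≤ Λ.M) :
    Λ.Fmin N kw β 1 ≤ B * ∑ p : Fin (N + 1), Set.indicator {y : ℝ | V < y} (fun y => y) (actT Λ Φ κ p z) := by
  have hΛ := hW.ok
  have hg0 := gRec_nonneg hΛ hG
  have hS := tailSum_ge hW hG hε hz hgood hκ hV hkK hkw hM
  have hS0 : 0 ≤ ∑ p : Fin (N + 1), Set.indicator {y : ℝ | V < y} (fun y => y) (actT Λ Φ κ p z) :=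
    le_trans (mul_nonneg (by unfold Lat.Tlow; positivity) (mul_nonneg hκ hg0)) hS
  have hT0 : 0 ≤ Λ.Tlow kw := by unfold Lat.Tlow; positivity
  have hwi : 0 < Λ.w⁻¹ := inv_pos.2 hw0
  -- `w⁻¹ gainT ≤ 2 κ gRec`
  have hgain : Λ.w⁻¹ * gainT Λ.P ≤ 2 * (κ * gRec Λ.P) := by
    have h1 : Λ.w⁻¹ * gainT Λ.P ≤ Λ.w⁻¹ * (2 * Λ.P.ε * gRec Λ.P) :=
      mul_le_mul_of_nonneg_left (gainT_le hΛ hG) hwi.le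
    have h2 : Λ.w⁻¹ * Λ.P.ε ≤ κ := by
      rw [inv_mul_le_iff₀ hw0]; linarith [hκε]
    calc Λ.w⁻¹ * gainT Λ.P ≤ Λ.w⁻¹ * (2 * Λ.P.ε * gRec Λ.P) := h1
      _ = 2 * (Λ.w⁻¹ * Λ.P.ε) * gRec Λ.P := by ring
      _ ≤ 2 * κ * gRec Λ.P := by gcongr
      _ = 2 * (κ * gRec Λ.P) := by ring
  have hmain : Λ.w⁻¹ * (Λ.Tlow kw * gainT Λ.P) ≤
      2 * ∑ p : Fin (N + 1), Set.indicator {y : ℝ | V < y} (fun y => y) (actT Λ Φ κ p z) := by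
    calc Λ.w⁻¹ * (Λ.Tlow kw * gainT Λ.P) = Λ.Tlow kw * (Λ.w⁻¹ * gainT Λ.P) := by ring
      _ ≤ Λ.Tlow kw * (2 * (κ * gRec Λ.P)) := mul_le_mul_of_nonneg_left hgain hT0
      _ = 2 * (Λ.Tlow kw * (κ * gRec Λ.P)) := by ring
      _ ≤ _ := by linarith [hS]
  unfold Lat.Fmin
  simp only [sub_self, abs_zero, zero_mul, mul_zero, sub_zero]
  calc β * (Λ.w⁻¹ * (Λ.Tlow kw * gainT Λ.P))
      ≤ β * (2 * ∑ p : Fin (N + 1), Set.indicator {y : ℝ | V < y} (fun y => y) (actT Λ Φ κ p z)) :=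
        mul_le_mul_of_nonneg_left hmain hβ
    _ = (2 * β) * ∑ p : Fin (N + 1), Set.indicator {y : ℝ | V < y} (fun y => y) (actT Λ Φ κ p z) := by ring
    _ ≤ B * ∑ p : Fin (N + 1), Set.indicator {y : ℝ | V < y} (fun y => y) (actT Λ Φ κ p z) :=
        mul_le_mul_of_nonneg_right hB hS0

end Lattice

end TransferActivityTailsNegative

end Summit.AtomisticToContinuum.HydrodynamicLimit.Theorems

end
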